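import Summits.Ventures.GridStability.Models.NE39SP39DroopQVHessBlocks1
import Summits.Ventures.GridStability.Models.NE39SP39DroopQVHessBlocks2
import Summits.Ventures.GridStability.Models.NE39SP39DroopQVHessBlocks3
import Summits.Ventures.GridStability.Models.NE39SP39DroopQVHessBlocks4
import Summits.Ventures.GridStability.Models.NE39SP39DroopQVHessBlocks5
import Summits.Ventures.GridStability.Models.DroopQVPortHamiltonianQGains

/-!
# GridStability/Models/NE39SP39DroopQVHessian — `𝒬(θ*, V*) + r rᵀ ≻ 0` for the 117-state construction «DROOPQV-NE39SP39», hence Hurwitz on the rotation quotient for EVERY positive loop-parameter set (156 parameters)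

Cell `gridfusion` (LADDER-GRIDFUSION, APEX LINE rung G3.b; seat gridfusion-model-8 (g4); default-work item (F) «G3.b-ss-DROOPQV-NE39SP39-ALL-LOOPS-HURWITZ»).
Assembly of the structural-twin Hessian certificate (data `Models/NE39SP39DroopQVHessData.lean`, twenty chunked closeness decides
`Models/NE39SP39DroopQVHessBlocks1–5.lean`) for ★ #108's object `NE39SP39.droopQV` (39 all-inverter droop+QV units on the NE39 branch graph, `G = 0`,
117 states; `Models/NE39SP39DroopQV.lean` p552509):
§1 `hess_gramCertZ` — the Gram certificate of the twin `G = L̃L̃ᵀ` is STRUCTURAL (`G − L̃L̃ᵀ = 0` by `DeflRows.matrixOfRows_gramRowsLT`, no kernel product);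
`hess_quadForm` — lit-5's `PSD.quadForm_nonneg_of_roundedTwin_ranges` ([cite: Rump1999VerifiedLargeSystems, §4 Algorithm 4.1 step 7]) on the twenty
ranges: `yᵀ(𝒬 + r rᵀ − (1/100)·1)y ≥ 0`; §2 symmetry of `𝒬` (lossless reciprocal network, generic `hessQ_transpose`) and `sp39_hessQ_add_rankOne_posDef`:
`𝒬(θ*, V*) + r rᵀ ≻ 0` on the state index; §3 the statements — `droopQV_eig_re_neg_or_rotation` (p525467's sharp solver-free theorem at the PRINTED
parameters: every eigenpair of the `117 × 117` Jacobian has `Re μ < 0` or is the rotation mode — ★ #108 gave the RATE `Re z < −1` by a Lyapunov certificate;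
this is the certificate-light SIGN twin) and `droopQV_allLoops_eig_re_neg_or_rotation`: the same for EVERY positive P–f gain vector `κ ∈ (0,∞)³⁹`, filter
constants `τ_P′, τ_Q′ ∈ (0,∞)³⁹` and Q–V gains `κ_Q ∈ (0, 1/5]³⁹` — `156` free loop parameters at operator size — by the congruence / monotonicity lemmas of
`Models/DroopQVPortHamiltonianGains/Filters/QGains.lean` (p564646 / p565654 / p567921); `…_no_jordan_chain_at_zero` likewise.
THREE COLUMNS. CERTIFIED (kernel): matrix statements about the MODEL `NE39SP39.droopQV.toMicrogrid` and its loop-parameter variants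
`(….withGainsTau κ τ_P′ τ_Q′).withKQ κ_Q`. MODELLED: MV-6N — SYNTHETIC/CONSTRUCTION as ★ #108 (NE39 branch reactances of record, `G = 0`, no shunts, no loads;
Table D.3 voltages; Kundu §V gains AS PRINTED [cite: KunduEtAl2019, §V] as the base point; set-points DEFINED from the point). VALIDATED: the float Cholesky
behind `L̃`. SIGN statements (no rate), never a region of attraction, never the printed New England system; no sentence of this file says a grid, a microgrid
or a converter is stable.
-/

noncomputable section

open Real Matrix Finset
open scoped ComplexOrder
open Literature.Computation.Certificates

namespace Summit.Ventures.GridStability.Models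

namespace NE39SP39

open DeflRows

/-! ## §1 The structural Gram certificate and the chunked closeness ⇒ nonnegative quadratic form of `𝒬 + r rᵀ − ε·1` -/

/-- **The twin's Gram certificate is structural**: `G = L̃L̃ᵀ` with unit weights and factor `L̃ᵀ` has residual `0`. [folklore] -/
theorem hess_gramCertZ :
    PSD.IsGramCertZ (matrixOfRows 117 117 (gramRowsLT 117 hessLt)) (fun _ : Fin 117 => 1) ((matrixOfRows 117 117 hessLt)ᵀ) := by
  have hres : PSD.gramResidualZ (matrixOfRows 117 117 (gramRowsLT 117 hessLt)) (fun _ : Fin 117 => 1) ((matrixOfRows 117 117 hessLt)ᵀ) = 0 := by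
    ext i j
    simp only [PSD.gramResidualZ, matrixOfRows_gramRowsLT 117 hessLt hessLt_len, Matrix.mul_apply, Matrix.transpose_apply, Nat.cast_one, one_mul,
      Matrix.zero_apply, sub_self]
  unfold PSD.IsGramCertZ PSD.IsDiagDominantZ
  rw [hres]
  simp

/-- The twenty chunked closeness facts, indexed. [folklore] -/
theorem hess_ranges : ∀ c : Fin 20, PSD.closeRangeN 117 1152921504606846976 8915039122860 76196915580 (c.val * 6) 6 hessRows (gramRowsLT 117 hessLt) = true := by
  intro c
  rcases c with ⟨c, hc⟩
  interval_cases c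
  · exact hessRange0
  · exact hessRange1
  · exact hessRange2
  · exact hessRange3
  · exact hessRange4
  · exact hessRange5
  · exact hessRange6
  · exact hessRange7
  · exact hessRange8
  · exact hessRange9
  · exact hessRange10
  · exact hessRange11
  · exact hessRange12
  · exact hessRange13
  · exact hessRange14
  · exact hessRange15
  · exact hessRange16
  · exact hessRange17
  · exact hessRange18
  · exact hessRange19

/-- **`yᵀ(𝒬 + r rᵀ − ε·1)y ≥ 0`** for every real `y` (flattened; lit-5's chunked rounded-twin lane with the structural Gram certificate). CERTIFIED. [folklore] -/
theorem hess_quadForm (y : Fin 117 → ℝ) : 0 ≤ ∑ i, ∑ j, y i * ((hessQfun i j : ℚ) : ℝ) * y j := by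
  have h := PSD.quadForm_nonneg_of_roundedTwin_ranges (R := ℝ) hess_gramCertZ (by norm_num) hess_ranges (by norm_num) (by norm_num) y
  simpa only [matrixOfRows_hessRows] using h

/-! ## §2 Symmetry and the positive definite Hessian certificate on the state index -/

/-- `𝒬(θ*, V*)` of the instance is symmetric (lossless reciprocal network, nonzero voltages). [folklore] -/
theorem sp39_hessQ_transpose :
    (NE39SP39.droopQV.toMicrogrid.hessQ NE39SP39.droopQV.angleOf NE39SP39.droopQV.Vstar)ᵀ
      = NE39SP39.droopQV.toMicrogrid.hessQ NE39SP39.droopQV.angleOf NE39SP39.droopQV.Vstar := by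
  refine droopQV.toMicrogrid.hessQ_transpose (fun i j => ?_) (fun i j => ?_) _ _ (fun i => ?_)
  · change ((droopQV.G i j : ℚ) : ℝ) = 0
    rw [droopQV_lossless.1 i j]; simp
  · change ((droopQV.B i j : ℚ) : ℝ) = ((droopQV.B j i : ℚ) : ℝ)
    rw [droopQV_lossless.2 i j]
  · have hV : ∀ i : Fin 39, droopQV.V i ≠ 0 := by decide +kernel
    change (droopQV.V i : ℝ) ≠ 0
    exact_mod_cast hV i

/-- The ℚ-twin `hessQQ` is symmetric (from the real symmetry by cast injectivity). [folklore] -/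
theorem droopQV_hessQQ_symm (a b : Fin 39 ⊕ (Fin 39 ⊕ Fin 39)) : droopQV.hessQQ a b = droopQV.hessQQ b a := by
  have hT := sp39_hessQ_transpose
  rw [droopQV.hessQ_eq droopQV_circle] at hT
  have h := congr_fun (congr_fun hT a) b
  simp only [Matrix.transpose_apply, Matrix.map_apply] at h
  exact_mod_cast h.symm

/-- `Q = 𝒬 + r rᵀ − ε·1` (flattened) is symmetric. [folklore] -/
theorem hessQfun_symm (i j : Fin 117) : hessQfun i j = hessQfun j i := by
  unfold hessQfun
  rw [Matrix.add_apply, Matrix.add_apply, Matrix.vecMulVec_apply, Matrix.vecMulVec_apply, droopQV_hessQQ_symm, mul_comm]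
  by_cases h : i = j
  · subst h; rfl
  · have h' : ¬ j = i := fun e => h e.symm
    simp [h, h']

/-- `Q ⪰ 0` (flattened, over `ℝ`). CERTIFIED. [folklore] -/
theorem hessShift_posSemidef : ((Matrix.of fun i j : Fin 117 => hessQfun i j).map ((↑) : ℚ → ℝ)).PosSemidef := by
  refine Matrix.PosSemidef.of_dotProduct_mulVec_nonneg ?_ fun x => ?_
  · rw [Matrix.IsHermitian, Matrix.conjTranspose_eq_transpose_of_trivial]
    ext i j
    simp only [Matrix.transpose_apply, Matrix.map_apply, Matrix.of_apply, hessQfun_symm j i]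
  · have e : star x ⬝ᵥ ((Matrix.of fun i j : Fin 117 => hessQfun i j).map ((↑) : ℚ → ℝ)) *ᵥ x
        = ∑ i, ∑ j, x i * ((hessQfun i j : ℚ) : ℝ) * x j := by
      simp only [star_trivial, dotProduct, Matrix.mulVec, Matrix.map_apply, Matrix.of_apply, Finset.mul_sum, mul_assoc]
    rw [e]; exact hess_quadForm x

/-- **`𝒬(θ*, V*) + r rᵀ ≻ 0`** for the 117-state instance, on the state index. CERTIFIED (structural twin + twenty closeness decides). [folklore] -/
theorem sp39_hessQ_add_rankOne_posDef :
    (NE39SP39.droopQV.toMicrogrid.hessQ NE39SP39.droopQV.angleOf NE39SP39.droopQV.Vstar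
      + (1 : ℝ) • Matrix.vecMulVec DroopMicrogrid.rot DroopMicrogrid.rot).PosDef := by
  -- the flattened shifted matrix, reindexed back to the state index, is `(hessQQ + r rᵀ).map − ε·1`
  have hsub : (((Matrix.of fun i j : Fin 117 => hessQfun i j).map ((↑) : ℚ → ℝ)).submatrix e117 e117).PosSemidef :=
    hessShift_posSemidef.submatrix e117
  have hmat : ((Matrix.of fun i j : Fin 117 => hessQfun i j).map ((↑) : ℚ → ℝ)).submatrix e117 e117
      = (droopQV.toMicrogrid.hessQ droopQV.angleOf droopQV.Vstar + (1 : ℝ) • Matrix.vecMulVec DroopMicrogrid.rot DroopMicrogrid.rot)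
          - ((hessEps : ℚ) : ℝ) • (1 : Matrix _ _ ℝ) := by
    rw [droopQV.hessQ_eq droopQV_circle, one_smul]
    ext a b
    simp only [Matrix.submatrix_apply, Matrix.map_apply, Matrix.of_apply, hessQfun, Matrix.add_apply, Matrix.vecMulVec_apply, Matrix.sub_apply,
      Matrix.smul_apply, Matrix.one_apply, Equiv.symm_apply_apply, smul_eq_mul, EmbeddingLike.apply_eq_iff_eq]
    push_cast
    congr 1
    · congr 1
      rcases a with i | i | i <;> rcases b with j | j | j <;> simp [DroopMicrogrid.rot, rotVecQ]
    · split_ifs <;> simp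
  rw [hmat] at hsub
  exact posDef_of_posSemidef_sub_smul_one (ε := ((hessEps : ℚ) : ℝ)) (by norm_num [hessEps]) hsub

/-! ## §3 The statements: sharp at the printed parameters, and for EVERY positive loop-parameter set -/

/-- **CERTIFIED, SOLVER-LIGHT, SHARP at `117` states: Hurwitz on the rotation quotient for «DROOPQV-NE39SP39» at the printed parameters.** Every complex
eigenpair `(μ, v)` of `jacMatrix (θ*, V*)` of `NE39SP39.droopQV.toMicrogrid` has `Re μ < 0`, or `μ = 0` with `v ∈ ℂ·r`. (★ #108 certifies the RATE `Re z < −1`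
by a Lyapunov certificate; this is the sign statement from the Hessian certificate alone.) CERTIFIED; MODELLED: MV-6N SYNTHETIC/CONSTRUCTION
[cite: KunduEtAl2019, eqs. (4a)–(4c)] [cite: ShinZavala2020, Prop. 1]. No stability sentence. -/
theorem droopQV_eig_re_neg_or_rotation {μ : ℂ} {v : Fin 39 ⊕ (Fin 39 ⊕ Fin 39) → ℂ} (hv : v ≠ 0)
    (hJ : (NE39SP39.droopQV.toMicrogrid.jacMatrix NE39SP39.droopQV.angleOf NE39SP39.droopQV.Vstar).map ((↑) : ℝ → ℂ) *ᵥ v = μ • v) :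
    μ.re < 0 ∨ (μ = 0 ∧ ∃ a : ℂ, v = fun k => a * ((DroopMicrogrid.rot k : ℝ) : ℂ)) := by
  have hg := fun i => droopQV.toMicrogrid_gains i
  have hVq : ∀ i : Fin 39, 0 < droopQV.V i := by decide +kernel
  refine droopQV.toMicrogrid.re_eig_neg_or_rotation_of_hessQ _ _ (fun i => ?_) (fun i => ?_) (fun i => ?_)
    (fun i => ?_) (fun i => ?_) (fun i => ?_) sp39_hessQ_transpose sp39_hessQ_add_rankOne_posDef hv hJ
  · rw [(hg i).2.2.1]; norm_num [droopQV]
  · rw [(hg i).1]; norm_num [droopQV]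
  · rw [(hg i).2.2.2.1]; norm_num [droopQV]
  · change (droopQV.V i : ℝ) ≠ 0
    exact_mod_cast (hVq i).ne'
  · rw [(hg i).2.2.1, (hg i).1]; norm_num [droopQV]
  · rw [(hg i).2.2.2.1, (hg i).2.1]
    have := hVq i
    simp only [DroopQVData.Vstar]
    norm_num [droopQV]
    positivity

/-- **«DROOPQV-NE39SP39» (117 states): Hurwitz on the rotation quotient for EVERY positive loop-parameter set — `156` free parameters.** For every positive
P–f gain vector `κ`, filter constants `τ_P′`, `τ_Q′` and every Q–V gain vector `κ_Q` with `0 < κ_Qi ≤ 1/5`, every complex eigenpair of the `117 × 117` Jacobian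
at `(θ*, V*)` of `(droopQV.toMicrogrid.withGainsTau κ τ_P′ τ_Q′).withKQ κ_Q` has `Re μ < 0` or is the rotation mode. CERTIFIED (the ONE Hessian certificate of
§2, transported by congruence + monotonicity); MODELLED: MV-6N SYNTHETIC/CONSTRUCTION, lossless, loop parameters free. No stability sentence. [folklore] -/
theorem droopQV_allLoops_eig_re_neg_or_rotation (κ τP' τQ' κQ : Fin 39 → ℝ) (hκ : ∀ i, 0 < κ i) (hτP' : ∀ i, 0 < τP' i) (hτQ' : ∀ i, 0 < τQ' i)
    (hκQ : ∀ i, 0 < κQ i) (hle : ∀ i, κQ i ≤ 1 / 5) {μ : ℂ} {v : Fin 39 ⊕ (Fin 39 ⊕ Fin 39) → ℂ} (hv : v ≠ 0)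
    (hJ : (((NE39SP39.droopQV.toMicrogrid.withGainsTau κ τP' τQ').withKQ κQ).jacMatrix NE39SP39.droopQV.angleOf NE39SP39.droopQV.Vstar).map
      ((↑) : ℝ → ℂ) *ᵥ v = μ • v) :
    μ.re < 0 ∨ (μ = 0 ∧ ∃ a : ℂ, v = fun k => a * ((DroopMicrogrid.rot k : ℝ) : ℂ)) := by
  have hg := fun i => droopQV.toMicrogrid_gains i
  have hVq : ∀ i : Fin 39, 0 < droopQV.V i := by decide +kernel
  refine droopQV.toMicrogrid.re_eig_neg_or_rotation_of_hessQ_allLoops κ τP' τQ' _ _ (fun i => ?_) (fun i => ?_) (fun i => ?_)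
    sp39_hessQ_transpose sp39_hessQ_add_rankOne_posDef hκ hτP' hτQ' hκQ (fun i => ?_) hv hJ
  · rw [(hg i).2.2.1]; norm_num [droopQV]
  · rw [(hg i).1]; norm_num [droopQV]
  · change (0 : ℝ) < (droopQV.V i : ℝ)
    exact_mod_cast hVq i
  · rw [(hg i).2.2.2.1]
    have h5 : ((droopQV.kQ i : ℚ) : ℝ) = 5⁻¹ := by norm_num [droopQV]
    rw [h5, inv_inv]
    exact (le_inv_comm₀ (by norm_num) (hκQ i)).2 (by simpa [one_div] using hle i)

/-- The rest point does not move with the loop parameters. [folklore] -/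
theorem droopQV_allLoops_field_eq_zero (κ τP' τQ' κQ : Fin 39 → ℝ) :
    ((NE39SP39.droopQV.toMicrogrid.withGainsTau κ τP' τQ').withKQ κQ).field (NE39SP39.droopQV.angleOf, 0, NE39SP39.droopQV.Vstar) = 0 :=
  ((droopQV.toMicrogrid.withGainsTau κ τP' τQ').withKQ_field_eq_zero κQ
    ((droopQV.toMicrogrid.withGainsTau_isSteadyState_iff κ τP' τQ' droopQV.angleOf).2 droopQV.isSteadyState))

/-- **SIMPLE rotation zero for every positive loop-parameter set** (117 states). CERTIFIED (structural); MODELLED as above. No stability sentence. [folklore] -/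
theorem droopQV_allLoops_no_jordan_chain_at_zero (κ τP' τQ' κQ : Fin 39 → ℝ) (hκ : ∀ i, 0 < κ i) (hτP' : ∀ i, 0 < τP' i) (hτQ' : ∀ i, 0 < τQ' i)
    (hκQ : ∀ i, 0 < κQ i) {w : Fin 39 ⊕ (Fin 39 ⊕ Fin 39) → ℂ}
    (hw : (((NE39SP39.droopQV.toMicrogrid.withGainsTau κ τP' τQ').withKQ κQ).jacMatrix NE39SP39.droopQV.angleOf NE39SP39.droopQV.Vstar).map
      ((↑) : ℝ → ℂ) *ᵥ w = fun k => ((DroopMicrogrid.rot k : ℝ) : ℂ)) : False := by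
  have hg := fun i => droopQV.toMicrogrid_gains i
  have hVq : ∀ i : Fin 39, 0 < droopQV.V i := by decide +kernel
  refine droopQV.toMicrogrid.no_jordan_chain_at_zero_of_hessQ_allLoops κ τP' τQ' _ _ (fun i => ?_) (fun i => ?_) (fun i => ?_)
    sp39_hessQ_transpose 0 hκ hτP' hτQ' hκQ hw
  · rw [(hg i).2.2.1]; norm_num [droopQV]
  · rw [(hg i).1]; norm_num [droopQV]
  · change (0 : ℝ) < (droopQV.V i : ℝ)
    exact_mod_cast hVq i

end NE39SP39

end Summit.Ventures.GridStability.Models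

end
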